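import Summits.ValiantsHypothesis.ValiantsHypothesis.Theorems.LacunarySymmetroidMatrixDescartesCensusDoorA34Lift
import Summits.ValiantsHypothesis.ValiantsHypothesis.Theorems.LacunarySymmetroidMatrixDescartesCensusNineteenRootStructure34

/-!
# `MatrixDescartes` census — DOOR A at `(3,4)`: RANK TWO and the CONIC TYPE at the roots of a hypothetical nineteen

HONEST FRAMING.  Object-search cell `pub-symmetroid`, route `LacunarySymmetroid`; this file sits beside ONE typed statement,
the route item `Theses.LacunarySymmetroid.DoorA34` (stmt-ValiantsHypothesis-19980) `= DoorA34 = PosRootLawAt 3 4 18` («every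
`4`-term real symmetric `3 × 3` lacunary pencil has at most `18` distinct positive det-roots»), which is OPEN and asserted
nowhere.  Every coefficient-level necessary condition the cell holds for a `(3,4)` pencil with `19` positive det-roots
(Descartes-sharpness, the C25 Newton cone, the Gårding rows of `…CensusLP34*`) needs a DEFINITE letter; the located open core is
the all-indefinite word.  This file continues `…CensusNineteenRootStructure34` (all roots simple, `P(r) ≠ 0`) ONE RANK FURTHER,
for ALL supports and with NO definiteness hypothesis:

* `det_add_smul_fin_three'`, `adjugate_eq_fin_three` (`adj A = A² − (tr A)·A + (tr adj A)·1`),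
  `two_mul_trace_adjugate_fin_three`, `trace_adjugate_mul_adjugate_fin_three` (`tr (adj A)² = (tr adj A)² − 2·det A·tr A`),
  `adjugate_neg_fin_three` — `3 × 3` identities over any commutative ring.
* `X_sub_C_sq_dvd_det_of_adjugate_eq_zero` — for a `3 × 3` POLYNOMIAL matrix `M`: if `M(r)` is singular with `adj M(r) = 0`
  (rank `≤ 1`) then `(X − r)² ∣ det M` (column multilinearity; no derivative is needed).
* `adjugate_pencil_ne_zero_of_nineteen` — **RANK TWO**: at every positive det-root `r` of a `(3,4)` pencil (ANY real letters)
  with `19` distinct positive det-roots, `adj P(r) ≠ 0`, i.e. `rank P(r) = 2` exactly.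
* SYMMETRIC letters — `trace_adjugate_pencil_ne_zero_of_nineteen`: at every such root `E₂(P(r)) = tr adj P(r) ≠ 0`; indeed
  `‖adj A‖² = (tr adj A)²` for a real symmetric singular `A` (`trace_adjugate_sq_eq_of_det_eq_zero`), and `adj A` is a rank-one
  matrix, semidefinite with the sign of its trace (`adjugate_mul_adjugate_of_det_eq_zero`, `trace_mul_quadForm_adjugate_eq`).
  The sign `ε(r) := sign tr adj P(r)` is the TYPE of the degenerate conic `P(r)`:
  `ε = +` ⟹ `P(r)` is semidefinite with the sign of its trace, `‖P(r)v‖² ≤ tr P(r)·vᵀP(r)v`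
  (`trace_mul_quadForm_nonneg_of_trace_adjugate_pos`; a conjugate pair of lines — in inertia language the step of `n₋` at `r`
  is `0 ↔ 1` or `2 ↔ 3`); `ε = −` ⟹ `P(r)` is indefinite (`indefinite_of_trace_adjugate_neg`; a REAL line pair — the step is
  `1 ↔ 2`).  The companion `…CensusDoorA34RootType` shows that `ε` changes at most `9` times along the roots.

NOTHING here bounds `ζ_sym(3,4)`; `DoorA34` stays OPEN; nothing bears on `MatrixDescartes` (stmt-ValiantsHypothesis-18050) or
on `VP ≠ VNP`.  [folklore] Linear algebra of real symmetric `3 × 3` matrices + Descartes' rule with multiplicity; no citation needed.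
-/

-- `Summit.ValiantsHypothesis.ValiantsHypothesis.…` repeats a component by the D-0017 layout
-- (single-conjunct summit), which the `dupNamespace` linter flags; the name is mandated.
set_option linter.dupNamespace false

namespace Summit.ValiantsHypothesis.ValiantsHypothesis.Theorems.LacunarySymmetroidMatrixDescartes.Census

open Polynomial Finset
open scoped BigOperators Polynomial Matrix
open Summit.ValiantsHypothesis.ValiantsHypothesis.Theorems.SymmetroidDescartes (eval_det_pencil)

/-! ## `3 × 3` identities over a commutative ring -/

section RingIdentities

variable {R : Type*} [CommRing R]

/-- `3 × 3` expansion over any commutative ring: `det (A + c·T) = det A + c·tr(adj A·T) + c²·tr(adj T·A) + c³·det T`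
(the tree's `det_add_smul_fin_three` is the case `R = ℝ`). [folklore] -/
theorem det_add_smul_fin_three' (A T : Matrix (Fin 3) (Fin 3) R) (c : R) :
    (A + c • T).det = A.det + c * (A.adjugate * T).trace + c ^ 2 * (T.adjugate * A).trace + c ^ 3 * T.det := by
  simp only [Matrix.det_fin_three, Matrix.adjugate_fin_three, Matrix.trace_fin_three, Matrix.mul_apply,
    Fin.sum_univ_three, Matrix.add_apply, Matrix.smul_apply, smul_eq_mul, Matrix.of_apply, Matrix.cons_val',
    Matrix.cons_val_zero, Matrix.cons_val_one, Matrix.cons_val_two, Matrix.empty_val', Matrix.cons_val_fin_one,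
    Matrix.head_cons, Matrix.tail_cons, Matrix.head_fin_const]
  ring

/-- Newton's identity at `3 × 3`: `2·tr adj A = (tr A)² − tr (A·A)` (`tr adj A = E₂(A)`, the sum of the principal
`2 × 2` minors). [folklore] -/
theorem two_mul_trace_adjugate_fin_three (A : Matrix (Fin 3) (Fin 3) R) :
    2 * A.adjugate.trace = A.trace ^ 2 - (A * A).trace := by
  simp only [Matrix.adjugate_fin_three, Matrix.trace_fin_three, Matrix.mul_apply, Fin.sum_univ_three,
    Matrix.of_apply, Matrix.cons_val', Matrix.cons_val_zero, Matrix.cons_val_one, Matrix.cons_val_two,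
    Matrix.empty_val', Matrix.cons_val_fin_one, Matrix.head_cons, Matrix.tail_cons, Matrix.head_fin_const]
  ring

/-- `3 × 3`: `tr (adj A · adj A) = (tr adj A)² − 2·det A·tr A` (Newton for `adj A`, whose `E₂` is `det A · tr A`). [folklore] -/
theorem trace_adjugate_mul_adjugate_fin_three (A : Matrix (Fin 3) (Fin 3) R) :
    (A.adjugate * A.adjugate).trace = A.adjugate.trace ^ 2 - 2 * A.det * A.trace := by
  simp only [Matrix.det_fin_three, Matrix.adjugate_fin_three, Matrix.trace_fin_three, Matrix.mul_apply,
    Fin.sum_univ_three, Matrix.of_apply, Matrix.cons_val', Matrix.cons_val_zero, Matrix.cons_val_one,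
    Matrix.cons_val_two, Matrix.empty_val', Matrix.cons_val_fin_one, Matrix.head_cons, Matrix.tail_cons,
    Matrix.head_fin_const]
  ring

/-- Cayley–Hamilton in adjugate form at `3 × 3`: `adj A = A·A − (tr A)·A + (tr adj A)·1`. [folklore] -/
theorem adjugate_eq_fin_three (A : Matrix (Fin 3) (Fin 3) R) :
    A.adjugate = A * A - A.trace • A + A.adjugate.trace • (1 : Matrix (Fin 3) (Fin 3) R) := by
  ext i j
  fin_cases i <;> fin_cases j <;>
    simp [Matrix.adjugate_fin_three, Matrix.trace_fin_three, Matrix.mul_apply, Fin.sum_univ_three] <;> ring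

end RingIdentities

/-! ## Rank `≤ 1` at a root forces a double root -/

/-- **Column multilinearity.**  Let `M` be a `3 × 3` matrix of real polynomials and `r` a real number at which `M(r)` is
singular with vanishing adjugate (all `2 × 2` minors of `M(r)` vanish, i.e. `rank M(r) ≤ 1`).  Then `(X − r)² ∣ det M`:
writing `M = M(r) + (X − r)·B`, the expansion `det_add_smul_fin_three'` has no term of order `< 2` in `X − r`. [folklore] -/
theorem X_sub_C_sq_dvd_det_of_adjugate_eq_zero (M : Matrix (Fin 3) (Fin 3) ℝ[X]) (r : ℝ)
    (hdet : (M.map (eval r)).det = 0) (hadj : (M.map (eval r)).adjugate = 0) :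
    (X - C r) ^ 2 ∣ M.det := by
  set M₀ : Matrix (Fin 3) (Fin 3) ℝ[X] := (C : ℝ →+* ℝ[X]).mapMatrix (M.map (eval r)) with hM₀
  set B : Matrix (Fin 3) (Fin 3) ℝ[X] := Matrix.of fun i j => (M i j - C ((M i j).eval r)) /ₘ (X - C r) with hB
  have hM : M = M₀ + (X - C r) • B := by
    refine Matrix.ext fun i j => ?_
    have hroot : (M i j - C ((M i j).eval r)).IsRoot r := by simp
    have h := (Polynomial.mul_divByMonic_eq_iff_isRoot).2 hroot
    simp only [hM₀, hB, Matrix.add_apply, Matrix.smul_apply, smul_eq_mul, RingHom.mapMatrix_apply,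
      Matrix.map_apply, Matrix.of_apply]
    rw [h]; ring
  have h0 : M₀.det = 0 := by
    rw [hM₀, ← RingHom.map_det, hdet, map_zero]
  have h1 : M₀.adjugate = 0 := by
    rw [hM₀, ← RingHom.map_adjugate, hadj]
    refine Matrix.ext fun i j => ?_
    simp
  rw [hM, det_add_smul_fin_three', h0, h1]
  refine ⟨(B.adjugate * M₀).trace + (X - C r) * B.det, ?_⟩
  simp only [Matrix.zero_mul, Matrix.trace_zero, mul_zero]
  ring

/-- The lacunary pencil evaluated: `(Σ_l X^{d l} S_l)(r) = Σ_l r^{d l} S_l`. [folklore] -/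
theorem map_eval_pencil {K m : ℕ} (d : Fin K → ℕ) (S : Fin K → Matrix (Fin m) (Fin m) ℝ) (r : ℝ) :
    (∑ l, ((X : ℝ[X]) ^ d l) • (S l).map C).map (eval r) = ∑ l, r ^ d l • S l := by
  refine Matrix.ext fun i j => ?_
  simp [Matrix.map_apply, Matrix.sum_apply, Matrix.smul_apply, Polynomial.eval_finsetSum]
  exact Finset.sum_congr rfl fun l _ => mul_comm _ _

/-- **Rank `≤ 1` at a positive root forces a double root** (any real letters, any format `3 × K`): if the pencil
determinant `f` is non-zero and `adj P(r) = 0` at a root `r`, then `2 ≤ rootMultiplicity r f`. [folklore] -/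
theorem two_le_rootMultiplicity_of_adjugate_eq_zero {K : ℕ} (d : Fin K → ℕ) (S : Fin K → Matrix (Fin 3) (Fin 3) ℝ)
    (r : ℝ) (hf0 : ((∑ l, ((X : ℝ[X]) ^ d l) • (S l).map C).det) ≠ 0)
    (hroot : ((∑ l, ((X : ℝ[X]) ^ d l) • (S l).map C).det).IsRoot r)
    (hadj : (∑ l, r ^ d l • S l).adjugate = 0) :
    2 ≤ ((∑ l, ((X : ℝ[X]) ^ d l) • (S l).map C).det).rootMultiplicity r := by
  rw [Polynomial.le_rootMultiplicity_iff hf0]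
  refine X_sub_C_sq_dvd_det_of_adjugate_eq_zero _ r ?_ ?_
  · rw [map_eval_pencil, ← eval_det_pencil S d r]; exact hroot
  · rw [map_eval_pencil]; exact hadj

/-! ## A nineteen has rank two at every root -/

/-- **Rank two at every root of a nineteen** (any real letters, any support): `adj P(r) ≠ 0` at each positive det-root
`r` of a `(3,4)` pencil with `19` distinct positive det-roots, i.e. `rank P(r) = 2` exactly (rank `≤ 1` would make `r` a double
root, against `rootMultiplicity_eq_one_of_nineteen`). [folklore] -/
theorem adjugate_pencil_ne_zero_of_nineteen (d : Fin 4 → ℕ) (S : Fin 4 → Matrix (Fin 3) (Fin 3) ℝ)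
    (h19 : 19 ≤ ((Matrix.det (∑ l, ((X : ℝ[X]) ^ d l) • (S l).map C)).roots.toFinset.filter (fun t => 0 < t)).card)
    {r : ℝ} (hr0 : 0 < r) (hr : (Matrix.det (∑ l, ((X : ℝ[X]) ^ d l) • (S l).map C)).IsRoot r) :
    (∑ l, r ^ d l • S l).adjugate ≠ 0 := by
  intro hadj
  have hf0 : Matrix.det (∑ l, ((X : ℝ[X]) ^ d l) • (S l).map C) ≠ 0 := by
    intro h0; rw [h0, Polynomial.roots_zero] at h19; simp at h19
  have h1 := rootMultiplicity_eq_one_of_nineteen d S h19 hr0 hr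
  have h2 := two_le_rootMultiplicity_of_adjugate_eq_zero d S r hf0 hr hadj
  omega

/-! ## Symmetric letters: `E₂ = tr adj ≠ 0` at the roots, and the conic type -/

/-- The adjugate of a symmetric matrix is symmetric. [folklore] -/
theorem isSymm_adjugate_of_isSymm {n : Type*} [Fintype n] [DecidableEq n] {R : Type*} [CommRing R]
    {A : Matrix n n R} (hA : A.IsSymm) : A.adjugate.IsSymm := by
  unfold Matrix.IsSymm at hA ⊢
  rw [Matrix.adjugate_transpose, hA]

/-- For a real symmetric SINGULAR `3 × 3` matrix, `‖adj A‖² = tr (adj A · adj A) = (tr adj A)²`. [folklore] -/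
theorem trace_adjugate_sq_eq_of_det_eq_zero {A : Matrix (Fin 3) (Fin 3) ℝ} (hdet : A.det = 0) :
    (A.adjugate * A.adjugate).trace = A.adjugate.trace ^ 2 := by
  rw [trace_adjugate_mul_adjugate_fin_three, hdet]; ring

/-- **`E₂ ≠ 0` where the rank is two.**  A real symmetric singular `3 × 3` matrix with `adj A ≠ 0` has `tr adj A ≠ 0`
(`tr adj A = E₂(A)`, the product of the two non-zero eigenvalues): `‖adj A‖² = (tr adj A)²`. [folklore] -/
theorem trace_adjugate_ne_zero_of_isSymm {A : Matrix (Fin 3) (Fin 3) ℝ} (hA : A.IsSymm) (hdet : A.det = 0)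
    (hadj : A.adjugate ≠ 0) : A.adjugate.trace ≠ 0 := by
  intro htr
  have hpos := trace_mul_self_pos_of_isSymm (isSymm_adjugate_of_isSymm hA) hadj
  rw [trace_adjugate_sq_eq_of_det_eq_zero hdet, htr] at hpos
  simp at hpos

/-- The evaluated symmetric pencil is symmetric. [folklore] -/
theorem isSymm_pencil_eval {K m : ℕ} (d : Fin K → ℕ) {S : Fin K → Matrix (Fin m) (Fin m) ℝ}
    (hS : ∀ l, (S l).IsSymm) (x : ℝ) : (∑ l, x ^ d l • S l).IsSymm := by
  unfold Matrix.IsSymm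
  rw [Matrix.transpose_sum]
  exact Finset.sum_congr rfl fun l _ => by rw [Matrix.transpose_smul, hS l]

/-- **`E₂(P(r)) ≠ 0` at every root of a symmetric nineteen**: with symmetric letters, `tr adj P(r) ≠ 0` at each positive
det-root `r` of a `(3,4)` pencil with `19` distinct positive det-roots (any support). [folklore] -/
theorem trace_adjugate_pencil_ne_zero_of_nineteen (d : Fin 4 → ℕ) (S : Fin 4 → Matrix (Fin 3) (Fin 3) ℝ)
    (hS : ∀ l, (S l).IsSymm)
    (h19 : 19 ≤ ((Matrix.det (∑ l, ((X : ℝ[X]) ^ d l) • (S l).map C)).roots.toFinset.filter (fun t => 0 < t)).card)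
    {r : ℝ} (hr0 : 0 < r) (hr : (Matrix.det (∑ l, ((X : ℝ[X]) ^ d l) • (S l).map C)).IsRoot r) :
    (∑ l, r ^ d l • S l).adjugate.trace ≠ 0 := by
  refine trace_adjugate_ne_zero_of_isSymm (isSymm_pencil_eval d hS r) ?_
    (adjugate_pencil_ne_zero_of_nineteen d S h19 hr0 hr)
  rw [← eval_det_pencil S d r]
  exact hr

/-! ### The type dichotomy: `tr adj A > 0` = semidefinite (conjugate line pair), `< 0` = indefinite (real line pair) -/

/-- For a real symmetric singular `3 × 3` matrix, `adj A · adj A = (tr adj A)·adj A` (the adjugate has rank `≤ 1`). [folklore] -/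
theorem adjugate_mul_adjugate_of_det_eq_zero {A : Matrix (Fin 3) (Fin 3) ℝ} (hdet : A.det = 0) :
    A.adjugate * A.adjugate = A.adjugate.trace • A.adjugate := by
  have h := adjugate_eq_fin_three A.adjugate
  have hadj2 : A.adjugate.adjugate = 0 := by
    rw [Matrix.adjugate_adjugate _ (by simp), hdet]
    simp
  rw [hadj2, Matrix.trace_zero, zero_smul, add_zero] at h
  -- `0 = adj A · adj A − (tr adj A)·adj A`
  have := sub_eq_zero.1 h.symm
  exact this

/-- quadratic-form bookkeeping on `Fin 3`: `v ⬝ (A (A v)) = (A v) ⬝ (A v)` for symmetric `A`. [folklore] -/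
theorem dotProduct_mulVec_mulVec_of_isSymm {A : Matrix (Fin 3) (Fin 3) ℝ} (hA : A.IsSymm) (v : Fin 3 → ℝ) :
    v ⬝ᵥ (A *ᵥ (A *ᵥ v)) = (A *ᵥ v) ⬝ᵥ (A *ᵥ v) := by
  rw [Matrix.dotProduct_mulVec, ← Matrix.mulVec_transpose, hA]

/-- **Sign coherence of the adjugate.**  For a real symmetric singular `3 × 3` matrix and every vector `v`:
`(tr adj A)·(vᵀ adj A v) = ‖adj A v‖² ≥ 0` — the rank-one matrix `adj A` is semidefinite with the sign of its trace. [folklore] -/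
theorem trace_mul_quadForm_adjugate_eq {A : Matrix (Fin 3) (Fin 3) ℝ} (hA : A.IsSymm) (hdet : A.det = 0)
    (v : Fin 3 → ℝ) :
    A.adjugate.trace * (v ⬝ᵥ (A.adjugate *ᵥ v)) = (A.adjugate *ᵥ v) ⬝ᵥ (A.adjugate *ᵥ v) := by
  have hN := isSymm_adjugate_of_isSymm hA
  rw [← dotProduct_mulVec_mulVec_of_isSymm hN, Matrix.mulVec_mulVec, adjugate_mul_adjugate_of_det_eq_zero hdet,
    Matrix.smul_mulVec, dotProduct_smul, smul_eq_mul]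

/-- Sign coherence, inequality form: `0 ≤ (tr adj A)·(vᵀ adj A v)`. [folklore] -/
theorem trace_mul_quadForm_adjugate_nonneg {A : Matrix (Fin 3) (Fin 3) ℝ} (hA : A.IsSymm) (hdet : A.det = 0)
    (v : Fin 3 → ℝ) : 0 ≤ A.adjugate.trace * (v ⬝ᵥ (A.adjugate *ᵥ v)) := by
  rw [trace_mul_quadForm_adjugate_eq hA hdet]
  simp only [dotProduct]
  exact Finset.sum_nonneg fun i _ => mul_self_nonneg _

/-- For a real symmetric singular `3 × 3` matrix with `tr adj A > 0`: `vᵀ adj A v ≤ (tr adj A)·‖v‖²`. [folklore] -/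
theorem quadForm_adjugate_le {A : Matrix (Fin 3) (Fin 3) ℝ} (hA : A.IsSymm) (hdet : A.det = 0)
    (hpos : 0 < A.adjugate.trace) (v : Fin 3 → ℝ) :
    v ⬝ᵥ (A.adjugate *ᵥ v) ≤ A.adjugate.trace * (v ⬝ᵥ v) := by
  set N := A.adjugate with hN
  have hcoh := trace_mul_quadForm_adjugate_eq hA hdet v
  have hvv : 0 ≤ v ⬝ᵥ v := by
    simp only [dotProduct]
    exact Finset.sum_nonneg fun i _ => mul_self_nonneg _
  -- Cauchy–Schwarz on `Fin 3` (Lagrange's identity)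
  have hcs : (v ⬝ᵥ (N *ᵥ v)) ^ 2 ≤ (v ⬝ᵥ v) * ((N *ᵥ v) ⬝ᵥ (N *ᵥ v)) := by
    set w := N *ᵥ v
    simp only [dotProduct, Fin.sum_univ_three]
    nlinarith [sq_nonneg (v 0 * w 1 - v 1 * w 0), sq_nonneg (v 0 * w 2 - v 2 * w 0),
      sq_nonneg (v 1 * w 2 - v 2 * w 1)]
  by_cases hq : 0 < v ⬝ᵥ (N *ᵥ v)
  · -- `(vNv)² ≤ ‖v‖²‖Nv‖² = ‖v‖²·(tr N)(vNv)`
    rw [← hcoh] at hcs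
    nlinarith
  · push Not at hq
    exact hq.trans (mul_nonneg hpos.le hvv)

/-- **Type `+` is a semidefinite conic.**  A real symmetric singular `3 × 3` matrix with `tr adj A > 0` is semidefinite with
the sign of its trace: `(tr A)·(vᵀ A v) ≥ ‖A v‖² ≥ 0` for every `v` (from `adj A = A² − (tr A)A + (tr adj A)·1`). In conic
language `P(r)` is a pair of complex-conjugate lines; in inertia language the two non-zero eigenvalues share a sign. [folklore] -/
theorem trace_mul_quadForm_nonneg_of_trace_adjugate_pos {A : Matrix (Fin 3) (Fin 3) ℝ} (hA : A.IsSymm)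
    (hdet : A.det = 0) (hpos : 0 < A.adjugate.trace) (v : Fin 3 → ℝ) :
    (A *ᵥ v) ⬝ᵥ (A *ᵥ v) ≤ A.trace * (v ⬝ᵥ (A *ᵥ v)) := by
  have h := adjugate_eq_fin_three A
  have hq : v ⬝ᵥ (A.adjugate *ᵥ v)
      = (A *ᵥ v) ⬝ᵥ (A *ᵥ v) - A.trace * (v ⬝ᵥ (A *ᵥ v)) + A.adjugate.trace * (v ⬝ᵥ v) := by
    conv_lhs => rw [h]
    rw [Matrix.add_mulVec, Matrix.sub_mulVec, dotProduct_add, dotProduct_sub, ← Matrix.mulVec_mulVec,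
      dotProduct_mulVec_mulVec_of_isSymm hA, Matrix.smul_mulVec, dotProduct_smul, Matrix.smul_mulVec,
      dotProduct_smul, Matrix.one_mulVec, smul_eq_mul, smul_eq_mul]
  have hle := quadForm_adjugate_le hA hdet hpos v
  rw [hq] at hle
  linarith

/-- the quadratic form of a symmetric `3 × 3` matrix on an explicit vector. [folklore] -/
theorem quadForm_vec3 {A : Matrix (Fin 3) (Fin 3) ℝ} (hA : A.IsSymm) (a b c : ℝ) :
    ![a, b, c] ⬝ᵥ (A *ᵥ ![a, b, c]) = A 0 0 * a ^ 2 + A 1 1 * b ^ 2 + A 2 2 * c ^ 2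
      + 2 * A 0 1 * a * b + 2 * A 0 2 * a * c + 2 * A 1 2 * b * c := by
  have hs : ∀ i j, A j i = A i j := fun i j => by
    have := congrFun (congrFun hA i) j
    simpa [Matrix.transpose_apply] using this
  simp only [dotProduct, Matrix.mulVec, Fin.sum_univ_three, Matrix.cons_val_zero, Matrix.cons_val_one,
    Matrix.cons_val_two, Matrix.head_cons, Matrix.tail_cons]
  rw [hs 0 1, hs 0 2, hs 1 2]
  ring

/-- discriminant bookkeeping: a binary quadratic form `p a² + 2 m a b + q b²` that is non-negative everywhere has
`p q − m² ≥ 0`. [folklore] -/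
theorem minor_nonneg_of_binary_nonneg {p q m : ℝ} (h : ∀ a b : ℝ, 0 ≤ p * a ^ 2 + 2 * m * a * b + q * b ^ 2) :
    0 ≤ p * q - m * m := by
  have hp : 0 ≤ p := by have := h 1 0; nlinarith
  by_cases hp0 : p = 0
  · subst hp0
    suffices hm : m = 0 by rw [hm]; simp
    by_contra hm
    have h1 := h (-(q + 1) / (2 * m)) 1
    have h2 : 2 * m * (-(q + 1) / (2 * m)) * 1 = -(q + 1) := by field_simp
    rw [h2] at h1
    nlinarith
  · have hp' : 0 < p := lt_of_le_of_ne hp (Ne.symm hp0)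
    have h1 := h m (-p)
    have h2 : p * m ^ 2 + 2 * m * m * -p + q * (-p) ^ 2 = p * (p * q - m * m) := by ring
    rw [h2] at h1
    by_contra hc
    push Not at hc
    have := mul_neg_of_pos_of_neg hp' hc
    linarith

/-- **Non-negative quadratic form ⇒ `tr adj A ≥ 0`** (the three principal `2 × 2` minors are `≥ 0`). [folklore] -/
theorem trace_adjugate_nonneg_of_quadForm_nonneg {A : Matrix (Fin 3) (Fin 3) ℝ} (hA : A.IsSymm)
    (hq : ∀ v, 0 ≤ v ⬝ᵥ (A *ᵥ v)) : 0 ≤ A.adjugate.trace := by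
  have hs : ∀ i j, A j i = A i j := fun i j => by
    have := congrFun (congrFun hA i) j
    simpa [Matrix.transpose_apply] using this
  have h01 : 0 ≤ A 0 0 * A 1 1 - A 0 1 * A 0 1 := by
    refine minor_nonneg_of_binary_nonneg fun a b => ?_
    have := hq ![a, b, 0]
    rw [quadForm_vec3 hA] at this
    nlinarith [this]
  have h02 : 0 ≤ A 0 0 * A 2 2 - A 0 2 * A 0 2 := by
    refine minor_nonneg_of_binary_nonneg fun a b => ?_
    have := hq ![a, 0, b]
    rw [quadForm_vec3 hA] at this
    nlinarith [this]
  have h12 : 0 ≤ A 1 1 * A 2 2 - A 1 2 * A 1 2 := by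
    refine minor_nonneg_of_binary_nonneg fun a b => ?_
    have := hq ![0, a, b]
    rw [quadForm_vec3 hA] at this
    nlinarith [this]
  rw [Matrix.adjugate_fin_three, Matrix.trace_fin_three]
  simp only [Matrix.of_apply, Matrix.cons_val', Matrix.cons_val_zero, Matrix.cons_val_one, Matrix.cons_val_two,
    Matrix.empty_val', Matrix.cons_val_fin_one, Matrix.head_cons, Matrix.tail_cons, Matrix.head_fin_const]
  rw [hs 0 1, hs 0 2, hs 1 2]
  linarith

/-- `adj (−A) = adj A` for `3 × 3` matrices. [folklore] -/
theorem adjugate_neg_fin_three {R : Type*} [CommRing R] (A : Matrix (Fin 3) (Fin 3) R) :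
    (-A).adjugate = A.adjugate := by
  ext i j
  rw [Matrix.adjugate_fin_three, Matrix.adjugate_fin_three]
  fin_cases i <;> fin_cases j <;> simp

/-- **Type `−` is an indefinite conic.**  A real symmetric `3 × 3` matrix with `tr adj A < 0` takes both signs as a
quadratic form (in conic language, a singular such `A` is a pair of REAL lines; in inertia language the two non-zero
eigenvalues have opposite signs). [folklore] -/
theorem indefinite_of_trace_adjugate_neg {A : Matrix (Fin 3) (Fin 3) ℝ} (hA : A.IsSymm)
    (hneg : A.adjugate.trace < 0) : (∃ v, v ⬝ᵥ (A *ᵥ v) < 0) ∧ (∃ w, 0 < w ⬝ᵥ (A *ᵥ w)) := by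
  constructor
  · by_contra h
    push Not at h
    exact absurd (trace_adjugate_nonneg_of_quadForm_nonneg hA h) (not_le.2 hneg)
  · by_contra h
    push Not at h
    have hA' : (-A).IsSymm := hA.neg
    have hq : ∀ v, 0 ≤ v ⬝ᵥ ((-A) *ᵥ v) := fun v => by
      rw [Matrix.neg_mulVec, dotProduct_neg]; linarith [h v]
    have h1 := trace_adjugate_nonneg_of_quadForm_nonneg hA' hq
    rw [adjugate_neg_fin_three] at h1
    linarith

/-- **THE CONIC TYPE AT A ROOT OF A SYMMETRIC NINETEEN (dichotomy).**  Let `P = Σ_l X^{d l} S_l` (real symmetric `3 × 3`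
letters, any support) have `19` distinct positive det-roots and let `r` be one of them.  Then `tr adj P(r) ≠ 0`, and
EITHER `tr adj P(r) > 0` and `P(r)` is semidefinite with the sign of its trace (`‖P(r)v‖² ≤ tr P(r) · vᵀP(r)v` for all `v`;
the conic `P(r)` is a conjugate pair of lines), OR `tr adj P(r) < 0` and `P(r)` is indefinite (a real line pair). [folklore] -/
theorem root_type_dichotomy_of_nineteen (d : Fin 4 → ℕ) (S : Fin 4 → Matrix (Fin 3) (Fin 3) ℝ)
    (hS : ∀ l, (S l).IsSymm)
    (h19 : 19 ≤ ((Matrix.det (∑ l, ((X : ℝ[X]) ^ d l) • (S l).map C)).roots.toFinset.filter (fun t => 0 < t)).card)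
    {r : ℝ} (hr0 : 0 < r) (hr : (Matrix.det (∑ l, ((X : ℝ[X]) ^ d l) • (S l).map C)).IsRoot r) :
    (0 < (∑ l, r ^ d l • S l).adjugate.trace ∧
        ∀ v, ((∑ l, r ^ d l • S l) *ᵥ v) ⬝ᵥ ((∑ l, r ^ d l • S l) *ᵥ v)
          ≤ (∑ l, r ^ d l • S l).trace * (v ⬝ᵥ ((∑ l, r ^ d l • S l) *ᵥ v))) ∨
      ((∑ l, r ^ d l • S l).adjugate.trace < 0 ∧
        (∃ v, v ⬝ᵥ ((∑ l, r ^ d l • S l) *ᵥ v) < 0) ∧ (∃ w, 0 < w ⬝ᵥ ((∑ l, r ^ d l • S l) *ᵥ w))) := by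
  have hA : (∑ l, r ^ d l • S l).IsSymm := isSymm_pencil_eval d hS r
  have hdet : (∑ l, r ^ d l • S l).det = 0 := by rw [← eval_det_pencil S d r]; exact hr
  have hne := trace_adjugate_pencil_ne_zero_of_nineteen d S hS h19 hr0 hr
  rcases lt_or_gt_of_ne hne with hneg | hpos
  · exact Or.inr ⟨hneg, indefinite_of_trace_adjugate_neg hA hneg⟩
  · exact Or.inl ⟨hpos, trace_mul_quadForm_nonneg_of_trace_adjugate_pos hA hdet hpos⟩

end Summit.ValiantsHypothesis.ValiantsHypothesis.Theorems.LacunarySymmetroidMatrixDescartes.Census
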